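import Summits.BirchSwinnertonDyer.BirchSwinnertonDyer.Theorems.ErratumRoadFiveSigmaLocalMultQuotient
import HarnessLib

/-!
# Route UniversalToricDescent — the inertia-coinvariant quotient `Q = E[p^∞] ⧸ ⟨σa − a : σ ∈ I_v⟩` at a
# MULTIPLICATIVE place `v ∤ p`: `#Q[p] = p` and Frobenius acts on `Q` as `ε = ±1`

Lead prover bsd-wall-utd-p1 g9 (`--supports stmt-BirchSwinnertonDyer-20399`). Input of the value of the
Greenberg–Vatsal (2.4) local term at a place of multiplicative reduction (sequel file), on top of the
`bsd-stepL` (S5-mult) files `ErratumRoadFiveSigmaLocalMult{Inertia,Quotient}` (`D = ⟨σa − a⟩` is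
`p`-divisible, `I_v`-fixed, non-trivially acted on; Frobenius is `ε` on `T_p Q`).

* §1 (algebra) `natCard_pTorsion_quotient_eq` — for a `p`-primary module `A` with `#A[p] = p²` and a
  `p`-divisible submodule `⊥ ≠ D ≠ ⊤`: **`#(A ⧸ D)[p] = p`** (`A[p] ↠ (A/D)[p]` with kernel `D[p]` of order
  `p`: not `p²` since `A[p] ⊆ D` would force `D = A`, not `1` since `D ≠ 0`);
  `natCard_pTorsion_zsmul_eq_nsmul` — on a group with `#Q[p] = p`: `#{x ∈ Q[p] : a x = b x} = p` if
  `p ∣ a − b`, else `1`; `prime_dvd_pow_prime_pow_sub_iff` — `p ∣ a^{p^R} − b^{p^R} ↔ p ∣ a − b` (Fermat).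
* §2 (the curve) `natCard_pTorsion_quotient_coinvSpan_eq` — **`#Q[p] = p`** for `Q = E[p^∞] ⧸ D` at a
  multiplicative `v ∤ p`; `quotient_frob_apply_eq_zsmul`, `quotient_frob_pow_apply_eq_zsmul` —
  **`ρ̄(φ) q = ε q`** (`ε = 1` split, `−1` non-split) for a local Frobenius `φ`, from the (S5-mult)
  statement on `T_p Q` (`tateModule_quotient_frob_eq`) by projecting to the finite levels
  (`T_p(E[p^∞]) ↠ E[p^n]`, `proj_surjective_of_isAlgClosed_holds`).

THEOREMS ONLY; no definition, no named fact, no `sorry`. BSD is not advanced by this file.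
References: [GreenbergVatsal2000] §2 Prop. (2.4) and proof (arXiv p. 22); [SilvermanATAEC1994] Thm. V.5.3,
Ex. 5.13; [SilvermanAEC2009] Cor. III.6.4.
-/

noncomputable section

open scoped Classical
open Field NumberField IsDedekindDomain WeierstrassCurve Module
open Literature.NumberTheory.EllipticCurves Literature.NumberTheory.GaloisRepresentations
  Literature.NumberTheory.EllipticCurves.BigGaloisRep
  Literature.NumberTheory.GaloisRepresentations.IsNonarchimedeanLocalField
  Summit.BirchSwinnertonDyer.BirchSwinnertonDyer.Theorems.SigmaLocal

set_option autoImplicit false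
-- `…BirchSwinnertonDyer.BirchSwinnertonDyer.Theorems…` is the problem's mandated namespace (D-0017).
set_option linter.dupNamespace false

namespace Summit.BirchSwinnertonDyer.BirchSwinnertonDyer.Theorems.UniversalToricDescentMultiplicativeCoinvariants

/-! ### §1 Algebra: the `p`-torsion of a quotient by a divisible submodule -/

section Algebra

/-- **`#(A ⧸ D)[p] = p`** for a `p`-primary module `A` with `#A[p] = p²` and a `p`-divisible submodule
`D` with `⊥ ≠ D ≠ ⊤`: the map `A[p] → (A/D)[p]` is onto (`D` divisible) with kernel `D[p] = D ∩ A[p]`, a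
subgroup of `A[p]` which is neither everything (then `D ⊇ A[p]` and inductively `D = A`) nor trivial
(`D ≠ 0` is `p`-primary), hence of order `p`. (For `A = E[p^∞]`: `D ≅ A/D ≅ ℚ_p/ℤ_p`.) [folklore] -/
theorem natCard_pTorsion_quotient_eq {p : ℕ} [hp : Fact p.Prime] {R : Type} [Ring R]
    {A : Type} [AddCommGroup A] [Module R A]
    (hA : ∀ a : A, ∃ k : ℕ, p ^ k • a = 0) (hcard : Nat.card {a : A // p • a = 0} = p ^ 2)
    (D : Submodule R A) (hdiv : ∀ d ∈ D, ∃ d' ∈ D, p • d' = d) (hbot : D ≠ ⊥) (htop : D ≠ ⊤) :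
    Nat.card {x : A ⧸ D // p • x = 0} = p := by
  classical
  have hpp : p.Prime := hp.out
  -- the `p`-torsion subgroup `A[p]` and its intersection with `D`
  let Ap : AddSubgroup A :=
    { carrier := {a | p • a = 0}
      zero_mem' := smul_zero _
      add_mem' := fun {a b} ha hb ↦ by
        show p • (a + b) = 0
        rw [smul_add, ha, hb, add_zero]
      neg_mem' := fun {a} ha ↦ by
        show p • (-a) = 0
        rw [smul_neg, ha, neg_zero] }
  have hAp : ∀ a, a ∈ Ap ↔ p • a = 0 := fun _ ↦ Iff.rfl
  haveI : Finite Ap := by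
    have h := Nat.finite_of_card_ne_zero (by rw [hcard]; exact pow_ne_zero 2 hpp.ne_zero :
      Nat.card {a : A // p • a = 0} ≠ 0)
    exact h
  have hcardAp : Nat.card Ap = p ^ 2 := hcard
  -- the map `A[p] → A/D`
  let f : Ap →+ A ⧸ D := D.mkQ.toAddMonoidHom.comp Ap.subtype
  have hf : ∀ a : Ap, f a = Submodule.Quotient.mk (a : A) := fun _ ↦ rfl
  -- its range is `(A/D)[p]`
  have hrange : Nat.card f.range = Nat.card {x : A ⧸ D // p • x = 0} := by
    refine Nat.card_congr (Equiv.subtypeEquivRight fun x ↦ ?_)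
    constructor
    · rintro ⟨a, rfl⟩
      rw [hf, ← Submodule.mkQ_apply, ← map_nsmul, (hAp a).mp a.2, map_zero]
    · intro hx
      obtain ⟨a, rfl⟩ := Submodule.Quotient.mk_surjective D x
      have hpa : p • a ∈ D := by
        rw [← Submodule.Quotient.mk_eq_zero, ← Submodule.mkQ_apply, map_nsmul]
        exact hx
      obtain ⟨d, hd, hpd⟩ := hdiv _ hpa
      refine ⟨⟨a - d, (hAp _).mpr (by rw [smul_sub, hpd, sub_self])⟩, ?_⟩
      rw [hf]
      exact (Submodule.Quotient.eq D).mpr (by rw [sub_sub_cancel_left]; exact D.neg_mem hd)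
  -- its kernel is `D[p]`
  have hker : ∀ a : Ap, a ∈ f.ker ↔ (a : A) ∈ D := fun a ↦ by
    rw [AddMonoidHom.mem_ker, hf, Submodule.Quotient.mk_eq_zero]
  -- `#D[p] = p`: not everything (else `D = ⊤`), not trivial (`D ≠ ⊥`), a divisor of `p²`
  have hker_ne_top : f.ker ≠ ⊤ := by
    intro h
    apply htop
    have hall : ∀ (k : ℕ) (a : A), p ^ k • a = 0 → a ∈ D := by
      intro k
      induction k with
      | zero => intro a hk; rw [pow_zero, one_smul] at hk; rw [hk]; exact D.zero_mem
      | succ k ih =>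
        intro a hk
        have hpa : p • a ∈ D := ih (p • a) (by rw [← mul_smul, ← pow_succ, hk])
        obtain ⟨d, hd, hpd⟩ := hdiv _ hpa
        have had : a - d ∈ D := by
          have hmem : (⟨a - d, (hAp _).mpr (by rw [smul_sub, hpd, sub_self])⟩ : Ap) ∈ f.ker := by
            rw [h]; exact AddSubgroup.mem_top _
          exact (hker _).mp hmem
        have := D.add_mem had hd
        rwa [sub_add_cancel] at this
    rw [eq_top_iff]
    rintro a -
    obtain ⟨k, hk⟩ := hA a
    exact hall k a hk
  have hker_ne_bot : f.ker ≠ ⊥ := by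
    intro h
    apply hbot
    rw [eq_bot_iff]
    intro d hd
    by_contra hd0
    -- some `p^j • d` is a non-zero element of `D[p]`
    have hex : ∀ (k : ℕ) (d : A), d ∈ D → p ^ k • d = 0 → d ≠ 0 →
        ∃ d₁ ∈ D, d₁ ≠ 0 ∧ p • d₁ = 0 := by
      intro k
      induction k with
      | zero => intro d _ hk hd0; rw [pow_zero, one_smul] at hk; exact absurd hk hd0
      | succ k ih =>
        intro d hd hk hd0
        by_cases hk' : p ^ k • d = 0
        · exact ih d hd hk' hd0
        · exact ⟨p ^ k • d, nsmul_mem hd _, hk', by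
            rw [← mul_smul, ← pow_succ', hk]⟩
    obtain ⟨k, hk⟩ := hA d
    obtain ⟨d₁, hd₁, hd₁0, hpd₁⟩ := hex k d hd hk hd0
    have hmem : (⟨d₁, (hAp _).mpr hpd₁⟩ : Ap) ∈ f.ker := (hker _).mpr hd₁
    rw [h, AddSubgroup.mem_bot] at hmem
    exact hd₁0 (congrArg Subtype.val hmem)
  have hcard_ker : Nat.card f.ker = p := by
    have hdvd : Nat.card f.ker ∣ p ^ 2 := hcardAp ▸ AddSubgroup.card_addSubgroup_dvd_card f.ker
    obtain ⟨i, hi, hci⟩ := (Nat.dvd_prime_pow hpp).mp hdvd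
    have hi2 : i ≠ 2 := by
      rintro rfl
      exact hker_ne_top (AddSubgroup.eq_top_of_card_eq _ (by rw [hci, hcardAp]))
    have hi0 : i ≠ 0 := by
      rintro rfl
      rw [pow_zero] at hci
      exact hker_ne_bot (AddSubgroup.eq_bot_of_card_eq _ hci)
    have hi1 : i = 1 := by omega
    rw [hci, hi1, pow_one]
  -- count: `#A[p] = #range · #ker`
  have hmul : Nat.card Ap = Nat.card f.range * Nat.card f.ker := by
    rw [Nat.card_congr (QuotientAddGroup.quotientKerEquivRange f).toEquiv.symm]
    exact AddSubgroup.card_eq_card_quotient_mul_card_addSubgroup f.ker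
  rw [hcardAp, hcard_ker, hrange, pow_two] at hmul
  exact (Nat.eq_of_mul_eq_mul_right hpp.pos hmul).symm

/-- On an abelian group with `#Q[p] = p` (an `𝔽_p`-line), the elements of `Q[p]` with `a • x = b • x`
(`a ∈ ℤ`, `b ∈ ℕ`) number `p` if `p ∣ a − b` and `1` otherwise (Bézout). [folklore] -/
theorem natCard_pTorsion_zsmul_eq_nsmul {p : ℕ} [hp : Fact p.Prime] {Q : Type} [AddCommGroup Q]
    (hQ : Nat.card {x : Q // p • x = 0} = p) (a : ℤ) (b : ℕ) :
    Nat.card {x : Q // p • x = 0 ∧ a • x = b • x} = if (p : ℤ) ∣ a - b then p else 1 := by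
  have hpp : p.Prime := hp.out
  split_ifs with hdvd
  · refine (Nat.card_congr (Equiv.subtypeEquivRight fun x ↦ ⟨fun h ↦ h.1, fun h ↦ ⟨h, ?_⟩⟩)).trans hQ
    obtain ⟨c, hc⟩ := hdvd
    rw [← sub_eq_zero, ← natCast_zsmul, ← sub_smul, hc, mul_comm, mul_smul, natCast_zsmul, h,
      smul_zero]
  · rw [Nat.card_eq_one_iff_exists]
    refine ⟨⟨0, smul_zero _, by rw [smul_zero, smul_zero]⟩, fun y ↦ Subtype.ext ?_⟩
    obtain ⟨x, hpx, hx⟩ := y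
    show x = 0
    have hab : (a - b) • x = 0 := by rw [sub_smul, natCast_zsmul, hx, sub_self]
    have hg : Int.gcd (a - b) p = 1 := by
      have hdvdp : (Int.gcd (a - b) p : ℤ) ∣ (p : ℤ) := Int.gcd_dvd_right (a - b) p
      have h1 : Int.gcd (a - b) p ∣ p := by exact_mod_cast hdvdp
      rcases (Nat.dvd_prime hpp).mp h1 with h | h
      · exact h
      · exfalso
        apply hdvd
        have h2 : (Int.gcd (a - b) p : ℤ) ∣ a - b := Int.gcd_dvd_left (a - b) p
        rw [h] at h2
        exact h2
    have hbez := Int.gcd_eq_gcd_ab (a - b) p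
    rw [hg, Nat.cast_one] at hbez
    calc x = (1 : ℤ) • x := (one_zsmul x).symm
      _ = ((a - b) * Int.gcdA (a - b) p + p * Int.gcdB (a - b) p) • x := by rw [← hbez]
      _ = 0 := by
        rw [add_smul, mul_comm, mul_smul, hab, smul_zero, mul_comm, mul_smul, natCast_zsmul, hpx,
          smul_zero, add_zero]

/-- Fermat: `p ∣ a^{p^R} − b^{p^R} ↔ p ∣ a − b` (`x ↦ x^p` is the identity of `ℤ/p`). [folklore] -/
theorem prime_dvd_pow_prime_pow_sub_iff {p : ℕ} [hp : Fact p.Prime] (a b : ℤ) (R : ℕ) :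
    (p : ℤ) ∣ a ^ p ^ R - b ^ p ^ R ↔ (p : ℤ) ∣ a - b := by
  have hfrob : ∀ x : ZMod p, x ^ p ^ R = x := fun x ↦ by
    induction R with
    | zero => rw [pow_zero, pow_one]
    | succ R ih => rw [pow_succ, pow_mul, ih, ZMod.pow_card]
  rw [← ZMod.intCast_zmod_eq_zero_iff_dvd, ← ZMod.intCast_zmod_eq_zero_iff_dvd, Int.cast_sub,
    Int.cast_sub, Int.cast_pow, Int.cast_pow, hfrob, hfrob]

end Algebra

/-! ### §2 The inertia-coinvariant quotient of `E[p^∞]` at a multiplicative place -/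

section Curve

variable {K : Type} [Field K] [NumberField K] (E : WeierstrassCurve K) [E.IsElliptic]
  (p : ℕ) [Fact p.Prime] {w : HeightOneSpectrum (𝓞 K)}

/-- `#E[p^∞][p] = #E[p] = p²` in the `PrimaryTorsion` currency. [cite: SilvermanAEC2009, Cor. III.6.4] -/
theorem natCard_pTorsion_primaryTorsion_eq_sq :
    Nat.card {a : PrimaryTorsion (geomPoints E) p // p • a = 0} = p ^ 2 := by
  have hpp : p.Prime := Fact.out
  have hV : Nat.card (E.geomTorsion (p : ℤ)) = p ^ 2 :=
    card_torsionPoints_eq_sq_holds E (AlgebraicClosure K) (by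
      haveI : CharZero (AlgebraicClosure K) :=
        charZero_of_injective_algebraMap (algebraMap K (AlgebraicClosure K)).injective
      exact_mod_cast hpp.ne_zero)
  rw [← hV]
  refine Nat.card_congr
    { toFun := fun a ↦ ⟨(a.1 : geomPoints E), (mem_geomTorsion_iff E (p : ℤ) _).mpr (by
        rw [natCast_zsmul, ← PrimaryTorsion.val_nsmul, a.2, PrimaryTorsion.val_zero])⟩
      invFun := fun P ↦ ⟨PrimaryTorsion.mk (P : geomPoints E) 1 (by
          rw [pow_one, ← natCast_zsmul]; exact (mem_geomTorsion_iff E (p : ℤ) _).mp P.2),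
        PrimaryTorsion.ext (by
          rw [PrimaryTorsion.val_nsmul, PrimaryTorsion.val_mk, PrimaryTorsion.val_zero, ← natCast_zsmul]
          exact (mem_geomTorsion_iff E (p : ℤ) _).mp P.2)⟩
      left_inv := fun a ↦ Subtype.ext (PrimaryTorsion.ext rfl)
      right_inv := fun P ↦ Subtype.ext rfl }

/-- **`#Q[p] = p` for `Q = E[p^∞] ⧸ D`, `D = ⟨σa − a : σ ∈ I_w⟩`, at a multiplicative `w ∤ p`**: `D` is
`p`-divisible (`exists_pow_nsmul_eq_of_mem_coinvSpan`), non-zero and proper (some `σ ∈ I_w` moves some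
`a ∈ E[p^∞]`, `exists_absInertia_primaryTorsionGaloisRep_ne`, while `D ⊆ E[p^∞]^{I_w}`,
`apply_eq_self_of_mem_coinvSpan`), and `#E[p] = p²`; so §1 applies. (`Q ≅ ℚ_p/ℤ_p`: Greenberg–Vatsal's
"`H¹((ℚ_∞)_η, E[p^∞])` has `ℤ_p`-corank one" at a multiplicative place.)
[cite: GreenbergVatsal2000, §2 Prop. (2.4) and proof (arXiv p. 22)] [cite: SilvermanATAEC1994, Ex. 5.13] -/
theorem natCard_pTorsion_quotient_coinvSpan_eq
    (hw : ((p : ℕ) : 𝓞 K) ∉ w.asIdeal) (hv : E.HasMultiplicativeReductionAt w) :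
    Nat.card {x : PrimaryTorsion (geomPoints E) p ⧸ (Submodule.span ℤ_[p] {x : PrimaryTorsion (geomPoints E) p |
        ∃ σ ∈ absInertia (w.adicCompletion K), ∃ a, x = ((E.primaryTorsionGaloisRep p).restrict (localMap K (Sum.inl w)) :
        ContinuousRep (absoluteGaloisGroup (w.adicCompletion K)) ℤ_[p] (PrimaryTorsion (geomPoints E) p)) σ a - a}) //
      p • x = 0} = p := by
  set ρ' : ContinuousRep (absoluteGaloisGroup (w.adicCompletion K)) ℤ_[p] (PrimaryTorsion (geomPoints E) p) :=
    (E.primaryTorsionGaloisRep p).restrict (localMap K (Sum.inl w)) with hρ'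
  set D := (Submodule.span ℤ_[p] {x : PrimaryTorsion (geomPoints E) p |
        ∃ σ ∈ absInertia (w.adicCompletion K), ∃ a, x = ρ' σ a - a}) with hD
  obtain ⟨σ, hσ, a, ha⟩ := exists_absInertia_primaryTorsionGaloisRep_ne E p hw hv
  refine natCard_pTorsion_quotient_eq (primaryTorsion_exists_pow_nsmul_eq_zero E p)
    (natCard_pTorsion_primaryTorsion_eq_sq E p) D (fun d hd ↦ ?_) (fun h ↦ ?_) (fun h ↦ ?_)
  · obtain ⟨d', hd', hpd'⟩ := exists_pow_nsmul_eq_of_mem_coinvSpan E p 1 d hd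
    exact ⟨d', hd', by rw [← hpd', pow_one]⟩
  · have hmem : ρ' σ a - a ∈ D := Submodule.subset_span ⟨σ, hσ, a, rfl⟩
    rw [h, Submodule.mem_bot, sub_eq_zero] at hmem
    exact ha hmem
  · have hmem : a ∈ D := by rw [h]; exact Submodule.mem_top
    exact ha (apply_eq_self_of_mem_coinvSpan E p hw hv hσ hmem)

/-- **Frobenius acts on `Q = E[p^∞] ⧸ D` as `ε`** (`ε = 1` split, `ε = −1` non-split multiplicative
reduction at `w ∤ p`), for a local Frobenius `φ` (`IsFrobPow φ 1`): `ρ̄(φ) q = ε • q`. From the (S5-mult)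
statement `T_p(ρ̄(φ)) = ε` on `T_p Q` (`tateModule_quotient_frob_eq`): every `q ∈ Q` is the `n`-th
component of an element of `T_p Q` (lift a representative to `T_p(E[p^∞])` by
`proj_surjective_of_isAlgClosed_holds` and push forward). [cite: GreenbergVatsal2000, §2, proof of Prop. (2.4) (arXiv p. 22)]
[cite: SilvermanATAEC1994, Thm. V.5.3, Ex. 5.11 (b), 5.13 (a)] -/
theorem quotient_frob_apply_eq_zsmul
    (hw : ((p : ℕ) : 𝓞 K) ∉ w.asIdeal) (hv : E.HasMultiplicativeReductionAt w)
    {φ : absoluteGaloisGroup (w.adicCompletion K)} (hφ : IsFrobPow φ 1) {ε : ℤ}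
    (hε : (E.HasSplitMultiplicativeReductionAt w ∧ ε = 1) ∨
      (¬ E.HasSplitMultiplicativeReductionAt w ∧ ε = -1))
    (q : PrimaryTorsion (geomPoints E) p ⧸ (Submodule.span ℤ_[p] {x : PrimaryTorsion (geomPoints E) p |
        ∃ σ ∈ absInertia (w.adicCompletion K), ∃ a, x = ((E.primaryTorsionGaloisRep p).restrict (localMap K (Sum.inl w)) :
        ContinuousRep (absoluteGaloisGroup (w.adicCompletion K)) ℤ_[p] (PrimaryTorsion (geomPoints E) p)) σ a - a})) :
    (((E.primaryTorsionGaloisRep p).restrict (localMap K (Sum.inl w)) :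
        ContinuousRep (absoluteGaloisGroup (w.adicCompletion K)) ℤ_[p] (PrimaryTorsion (geomPoints E) p))).quotient (Submodule.span ℤ_[p] {x : PrimaryTorsion (geomPoints E) p |
        ∃ σ ∈ absInertia (w.adicCompletion K), ∃ a, x = ((E.primaryTorsionGaloisRep p).restrict (localMap K (Sum.inl w)) :
        ContinuousRep (absoluteGaloisGroup (w.adicCompletion K)) ℤ_[p] (PrimaryTorsion (geomPoints E) p)) σ a - a}) (coinvSpan_le_comap E p) φ q =
      ε • q := by
  induction q using Submodule.Quotient.induction_on with | _ a => ?_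
  set ρ' : ContinuousRep (absoluteGaloisGroup (w.adicCompletion K)) ℤ_[p] (PrimaryTorsion (geomPoints E) p) :=
    (E.primaryTorsionGaloisRep p).restrict (localMap K (Sum.inl w)) with hρ'
  set D := (Submodule.span ℤ_[p] {x : PrimaryTorsion (geomPoints E) p |
        ∃ σ ∈ absInertia (w.adicCompletion K), ∃ a, x = ρ' σ a - a}) with hD
  have hε' : (E.HasSplitMultiplicativeReductionAt w ∧ ((ε : ℤ) : ℤ_[p]) = 1) ∨
      (¬ E.HasSplitMultiplicativeReductionAt w ∧ ((ε : ℤ) : ℤ_[p]) = -1) := by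
    rcases hε with ⟨h, rfl⟩ | ⟨h, rfl⟩
    · exact Or.inl ⟨h, by rw [Int.cast_one]⟩
    · exact Or.inr ⟨h, by rw [Int.cast_neg, Int.cast_one]⟩
  -- lift `a` to `T_p(E[p^∞])` and push to `T_p Q`
  obtain ⟨n, hn⟩ := a.exists_pow_smul_eq_zero
  have ha' : (a : geomPoints E) ∈ geomTorsion E ((p ^ n : ℕ) : ℤ) := by
    rw [mem_geomTorsion_iff, natCast_zsmul]; exact hn
  obtain ⟨x, hx⟩ := proj_surjective_of_isAlgClosed_holds E p n ha'
  obtain ⟨e8, he8⟩ := TateModule.exists_linearEquiv_primaryTorsion (geomPoints E) p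
  have hs : TateModule.proj p n (e8.symm x) = a := by
    apply PrimaryTorsion.ext
    rw [← he8, LinearEquiv.apply_symm_apply, hx]
  have ht : TateModule.proj p n (TateModule.map p D.mkQ.toAddMonoidHom (e8.symm x)) =
      Submodule.Quotient.mk a := by
    rw [TateModule.proj_map, hs]; rfl
  have key := congrArg (TateModule.proj p n)
    (tateModule_quotient_frob_eq E p hw hv hφ hε' (TateModule.map p D.mkQ.toAddMonoidHom (e8.symm x)))
  rw [TateModule.proj_map, Int.cast_smul_eq_zsmul, map_zsmul, ht] at key
  exact key

/-- Powers: `ρ̄(φ^k) q = ε^k • q` on `Q = E[p^∞] ⧸ D` at a multiplicative `w ∤ p`.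
[cite: GreenbergVatsal2000, §2, proof of Prop. (2.4) (arXiv p. 22)] -/
theorem quotient_frob_pow_apply_eq_zsmul
    (hw : ((p : ℕ) : 𝓞 K) ∉ w.asIdeal) (hv : E.HasMultiplicativeReductionAt w)
    {φ : absoluteGaloisGroup (w.adicCompletion K)} (hφ : IsFrobPow φ 1) {ε : ℤ}
    (hε : (E.HasSplitMultiplicativeReductionAt w ∧ ε = 1) ∨
      (¬ E.HasSplitMultiplicativeReductionAt w ∧ ε = -1)) (k : ℕ)
    (q : PrimaryTorsion (geomPoints E) p ⧸ (Submodule.span ℤ_[p] {x : PrimaryTorsion (geomPoints E) p |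
        ∃ σ ∈ absInertia (w.adicCompletion K), ∃ a, x = ((E.primaryTorsionGaloisRep p).restrict (localMap K (Sum.inl w)) :
        ContinuousRep (absoluteGaloisGroup (w.adicCompletion K)) ℤ_[p] (PrimaryTorsion (geomPoints E) p)) σ a - a})) :
    (((E.primaryTorsionGaloisRep p).restrict (localMap K (Sum.inl w)) :
        ContinuousRep (absoluteGaloisGroup (w.adicCompletion K)) ℤ_[p] (PrimaryTorsion (geomPoints E) p))).quotient (Submodule.span ℤ_[p] {x : PrimaryTorsion (geomPoints E) p |
        ∃ σ ∈ absInertia (w.adicCompletion K), ∃ a, x = ((E.primaryTorsionGaloisRep p).restrict (localMap K (Sum.inl w)) :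
        ContinuousRep (absoluteGaloisGroup (w.adicCompletion K)) ℤ_[p] (PrimaryTorsion (geomPoints E) p)) σ a - a}) (coinvSpan_le_comap E p) (φ ^ k) q =
      (ε ^ k) • q := by
  induction k generalizing q with
  | zero => rw [pow_zero, map_one, Module.End.one_apply, pow_zero, one_zsmul]
  | succ k ih =>
    rw [pow_succ', map_mul, Module.End.mul_apply, ih, map_zsmul,
      quotient_frob_apply_eq_zsmul E p hw hv hφ hε, smul_smul, ← pow_succ]

end Curve

end Summit.BirchSwinnertonDyer.BirchSwinnertonDyer.Theorems.UniversalToricDescentMultiplicativeCoinvariants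

end
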